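import Mathlib
import Summits.ValiantsHypothesis.ValiantsHypothesis.Theorems.FifoMatchingNNLinearDegreeCofactorHardShedWordCoins
import HarnessLib

/-!
# Crux `NNLinearDegreeCofactorHard` (stmt-ValiantsHypothesis-23918), line `internal_cofactor`, stub S2b (ii):
# μ* = shedWord — the GATE kind (κ = 2) and its elementary API

Coins are the positions `j < N`.  At a fair coin `j` the front item `k = pops (prefix j)` is an S-item of colour
`c = posColour S (push position of k)`; behind it, among the items ALREADY PUSHED, comes a LOOK-AHEAD CHAIN: items
`k+1, …, k+L-1` pushed at defects (R-items) of colour `c`, and item `k+L` which is the first one that is either an S-item or of a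
colour `≠ c` (`lookLenL`).  Popping `k` at a non-defect position `t` forces the R-items of the chain to be shed at the next
`L-1` non-defect positions after `t` (`freeIter R t 1, …`), and item `k+L` to reach the front at `freeIter R t L`.  The coin `j`
is a GATE (`isGate`) when it is fair, item `k+L` has colour `≠ c` (a colour change — the only priced event), `freeIter R j L < E`,
and the colours of the positions `freeIter R j l` (`l ≤ L`) are exactly the colours of the chain (`goodExitL`): popping NOW is the
move a respecting word can make for free; the gate's designated value is `D`.

This file: the definitions (all functions of the PREFIX, hence past-measurable: `isGate_eq_of_agree`, `kind_eq_of_agree`), the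
`Nat.find` / iteration API (`nextFree`, `freeIter`, `lookLenL`), prefix stability of item colours (`pcol_eq`, `pR_eq`), the kind
`kind ∈ {0,1,2}` and designated value `desig` fed to `CondProbBits.card_mul_le_of_passages_succ`, a gate is never a test
(`isTest_eq_false_of_isGate`), the pure THREE-CASE LEMMA `no_two_goodExits` (two good-exit coins of one front period have a test
between them) and the counting lemma `card_le_card_add_one_of_between`.  The dynamics and the two attribution inequalities are
the sequel.  Nothing here proves S2b, the crux or VP ≠ VNP (not proved). [folklore]
-/

noncomputable section

-- Sub = Summit single-conjunct layout: the duplicated namespace component is mandated by the tree.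
set_option linter.dupNamespace false

namespace Summit.ValiantsHypothesis.ValiantsHypothesis.Theorems.FifoMatching.NNLinearDegreeCofactorHard.ShedWord

open Finset Literature.Computability.AlgebraicComplexity
open Summit.ValiantsHypothesis.ValiantsHypothesis.Theorems.FifoMatching.NNMonotoneHard
open Summit.ValiantsHypothesis.ValiantsHypothesis.Theorems.FifoMatching.NNLinearDegreeCofactorHard.QueueHistory
open Summit.ValiantsHypothesis.ValiantsHypothesis.Theorems.FifoMatching.NNLinearDegreeCofactorHard.CondProbBits

variable {N : ℕ} (R : Finset (Fin N)) (H E : ℕ)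

/-! ### Non-defect positions: `nextFree`, `freeIter` -/

/-- Positions past the window are not defects. [folklore] -/
theorem isDefect_eq_false_of_le {s : ℕ} (hs : N ≤ s) : isDefect R s = false := by
  unfold isDefect
  rw [decide_eq_false_iff_not]
  simp only [mem_map, Fin.valEmbedding_apply, not_exists, not_and]
  intro i _ hi
  have := i.isLt
  omega

/-- There is a non-defect position after every `t`. [folklore] -/
theorem exists_free_gt (t : ℕ) : ∃ s, t < s ∧ isDefect R s = false :=
  ⟨max (t + 1) N, by omega, isDefect_eq_false_of_le R (le_max_right _ _)⟩

/-- The next non-defect position after `t`. [folklore] -/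
def nextFree (t : ℕ) : ℕ := Nat.find (exists_free_gt R t)

/-- `nextFree` is later. [folklore] -/
theorem lt_nextFree (t : ℕ) : t < nextFree R t := (Nat.find_spec (exists_free_gt R t)).1

/-- `nextFree` is a non-defect position. [folklore] -/
theorem isDefect_nextFree (t : ℕ) : isDefect R (nextFree R t) = false := (Nat.find_spec (exists_free_gt R t)).2

/-- Positions strictly between `t` and `nextFree t` are defects. [folklore] -/
theorem isDefect_of_lt_nextFree {t s : ℕ} (hts : t < s) (hs : s < nextFree R t) : isDefect R s = true := by
  have h := Nat.find_min (exists_free_gt R t) hs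
  rw [not_and, Bool.eq_false_iff, not_not] at h
  exact h hts

/-- Minimality: a later non-defect position bounds `nextFree`. [folklore] -/
theorem nextFree_le {t s : ℕ} (hts : t < s) (hs : isDefect R s = false) : nextFree R t ≤ s :=
  Nat.find_min' (exists_free_gt R t) ⟨hts, hs⟩

/-- The `i`-th non-defect position after `t` (`freeIter R t 0 = t`). [folklore] -/
def freeIter (t i : ℕ) : ℕ := (nextFree R)^[i] t

/-- `freeIter R t 0 = t`. [folklore] -/
theorem freeIter_zero (t : ℕ) : freeIter R t 0 = t := rfl

/-- The successor iterate. [folklore] -/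
theorem freeIter_succ (t i : ℕ) : freeIter R t (i + 1) = nextFree R (freeIter R t i) := by
  unfold freeIter; rw [Function.iterate_succ_apply']

/-- Additivity of the iterates. [folklore] -/
theorem freeIter_add (t i j : ℕ) : freeIter R t (i + j) = freeIter R (freeIter R t i) j := by
  unfold freeIter; rw [add_comm, Function.iterate_add_apply]

/-- The iterates increase strictly. [folklore] -/
theorem freeIter_lt_freeIter {t i j : ℕ} (hij : i < j) : freeIter R t i < freeIter R t j := by
  induction j with
  | zero => omega
  | succ j ih =>
    rw [freeIter_succ]
    rcases Nat.lt_succ_iff_lt_or_eq.1 hij with h | h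
    · exact (ih h).trans (lt_nextFree R _)
    · rw [h]; exact lt_nextFree R _

/-- The iterates are monotone. [folklore] -/
theorem freeIter_le_freeIter {t i j : ℕ} (hij : i ≤ j) : freeIter R t i ≤ freeIter R t j := by
  rcases hij.lt_or_eq with h | h
  · exact (freeIter_lt_freeIter R h).le
  · rw [h]

/-- Positive iterates are non-defect positions. [folklore] -/
theorem isDefect_freeIter {t i : ℕ} (hi : 1 ≤ i) : isDefect R (freeIter R t i) = false := by
  obtain ⟨i, rfl⟩ : ∃ i', i = i' + 1 := ⟨i - 1, by omega⟩
  rw [freeIter_succ]; exact isDefect_nextFree R _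

/-- Every non-defect position after `t` is an iterate. [folklore] -/
theorem exists_freeIter_eq {t s : ℕ} (hts : t < s) (hs : isDefect R s = false) : ∃ a, 1 ≤ a ∧ freeIter R t a = s := by
  suffices h : ∀ d t : ℕ, s - t ≤ d → t < s → ∃ a, 1 ≤ a ∧ freeIter R t a = s from h (s - t) t le_rfl hts
  intro d
  induction d with
  | zero => intro t hd ht; omega
  | succ d ih =>
    intro t hd ht
    have hu := nextFree_le R ht hs
    rcases hu.lt_or_eq with hlt | heq
    · obtain ⟨a, ha, has⟩ := ih (nextFree R t) (by have := lt_nextFree R t; omega) hlt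
      refine ⟨1 + a, by omega, ?_⟩
      rw [freeIter_add, freeIter_succ, freeIter_zero]
      exact has
    · exact ⟨1, le_rfl, by rw [freeIter_succ, freeIter_zero]; exact heq⟩

/-! ### Item colours read off the prefix -/

variable (y : Fin N → Bool) (S : Finset (Fin N))

/-- The colour of item `k` as read off a prefix `P` (junk past `pushes P`). [folklore] -/
def pcolL (P : List Bool) (k : ℕ) : Bool := posColour S (nthTrue P k)

/-- Whether item `k` was pushed at a defect, as read off a prefix `P` (junk past `pushes P`). [folklore] -/
def pRL (P : List Bool) (k : ℕ) : Bool := isDefect R (nthTrue P k)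

/-- Prefix stability of push positions: an item pushed before `t` has the same push position in every longer prefix. [folklore] -/
theorem nthTrue_shedPrefix_eq {t k : ℕ} (ht : t ≤ N) (hk : k < pushes (shedPrefix R H E y t)) :
    nthTrue (shedPrefix R H E y t) k = nthTrue (shedPrefix R H E y N) k := by
  have hsplit : shedPrefix R H E y N = shedPrefix R H E y t ++ (shedPrefix R H E y N).drop t := by
    conv_lhs => rw [← List.take_append_drop t (shedPrefix R H E y N)]
    rw [take_shedPrefix R H E y ht]
  rw [hsplit, nthTrue_append_of_lt _ _ _ hk]

/-- The prefix colour of a pushed item is the colour of its push time. [folklore] -/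
theorem pcolL_eq {t k : ℕ} (ht : t ≤ N) (hk : k < pushes (shedPrefix R H E y t)) :
    pcolL S (shedPrefix R H E y t) k = posColour S (openTime R H E y k) := by
  have hkN : k < (openerSet (shedWord R H E y)).card :=
    lt_of_lt_of_le hk (by rw [← pushes_shedPrefix_N]; exact pushes_mono R H E y ht)
  unfold pcolL
  rw [nthTrue_shedPrefix_eq R H E y ht hk, openTime_eq_nthTrue R H E y hkN]

/-- The prefix R-flag of a pushed item is `isRItem`. [folklore] -/
theorem pRL_eq {t k : ℕ} (ht : t ≤ N) (hk : k < pushes (shedPrefix R H E y t)) :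
    pRL R (shedPrefix R H E y t) k = isRItem R H E y k := by
  unfold pRL isRItem
  rw [nthTrue_shedPrefix_eq R H E y ht hk]

/-! ### The look-ahead chain and the gate -/

/-- The look-ahead length is well defined. [folklore] -/
theorem exists_lookLen (P : List Bool) : ∃ l, 1 ≤ l ∧ (pushes P ≤ pops P + l ∨
    pcolL S P (pops P + l) ≠ pcolL S P (pops P) ∨ pRL R P (pops P + l) = false) :=
  ⟨pushes P + 1, by omega, Or.inl (by omega)⟩

/-- The LOOK-AHEAD LENGTH `L ≥ 1` of a prefix: the least `l ≥ 1` such that item `front + l` is not pushed yet, or has a colour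
different from the front's, or is an S-item. [folklore] -/
def lookLenL (P : List Bool) : ℕ := Nat.find (exists_lookLen R S P)

/-- `lookLenL ≥ 1` and the defining property holds at it. [folklore] -/
theorem lookLenL_spec (P : List Bool) : 1 ≤ lookLenL R S P ∧ (pushes P ≤ pops P + lookLenL R S P ∨
    pcolL S P (pops P + lookLenL R S P) ≠ pcolL S P (pops P) ∨ pRL R P (pops P + lookLenL R S P) = false) :=
  Nat.find_spec (exists_lookLen R S P)

/-- Minimality: below the look-ahead length the items are pushed R-items of the front's colour. [folklore] -/
theorem lookLenL_min (P : List Bool) {l : ℕ} (hl1 : 1 ≤ l) (hl : l < lookLenL R S P) :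
    pops P + l < pushes P ∧ pcolL S P (pops P + l) = pcolL S P (pops P) ∧ pRL R P (pops P + l) = true := by
  have h := Nat.find_min (exists_lookLen R S P) hl
  rw [not_and_or] at h
  rcases h with h | h
  · exact absurd hl1 h
  · rw [not_or, not_or, not_le, Ne, not_not, Bool.not_eq_false] at h
    exact h

/-- Characterisation of the look-ahead length by its defining properties. [folklore] -/
theorem lookLenL_eq_of (P : List Bool) {L : ℕ} (hL1 : 1 ≤ L)
    (hL : pushes P ≤ pops P + L ∨ pcolL S P (pops P + L) ≠ pcolL S P (pops P) ∨ pRL R P (pops P + L) = false)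
    (hmin : ∀ l, 1 ≤ l → l < L →
      pops P + l < pushes P ∧ pcolL S P (pops P + l) = pcolL S P (pops P) ∧ pRL R P (pops P + l) = true) :
    lookLenL R S P = L := by
  unfold lookLenL
  rw [Nat.find_eq_iff]
  refine ⟨⟨hL1, hL⟩, fun l hl h => ?_⟩
  obtain ⟨h1, h2, h3⟩ := hmin l h.1 hl
  rcases h.2 with h' | h' | h'
  · omega
  · exact h' h2
  · rw [h3] at h'; exact Bool.noConfusion h'

/-- The GOOD-EXIT condition of a prefix `P` at position `t`: the look-ahead item is pushed and has a colour different from the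
front's, it would reach the front before `E`, and the colours of the next non-defect positions after `t` are exactly the colours
of the chain. [folklore] -/
def goodExitL (P : List Bool) (t : ℕ) : Bool :=
  decide (pops P + lookLenL R S P < pushes P) && (pcolL S P (pops P + lookLenL R S P) != pcolL S P (pops P)) &&
    decide (freeIter R t (lookLenL R S P) < E) &&
      (List.range (lookLenL R S P + 1)).all fun l => posColour S (freeIter R t l) == pcolL S P (pops P + l)

/-- Unfolding the good-exit condition. [folklore] -/
theorem goodExitL_iff (P : List Bool) (t : ℕ) : goodExitL R E S P t = true ↔
    pops P + lookLenL R S P < pushes P ∧ pcolL S P (pops P + lookLenL R S P) ≠ pcolL S P (pops P) ∧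
      freeIter R t (lookLenL R S P) < E ∧
        ∀ l, l ≤ lookLenL R S P → posColour S (freeIter R t l) = pcolL S P (pops P + l) := by
  unfold goodExitL
  simp only [Bool.and_eq_true, decide_eq_true_eq, List.all_eq_true, List.mem_range, beq_iff_eq, bne_iff_ne, ne_eq,
    Nat.lt_succ_iff]
  tauto

/-- The GATE kind of coin `j` (κ = 2, designated value `D`): fair and good exit. [folklore] -/
def isGate (j : ℕ) : Bool := isFair R H E y j && goodExitL R E S (shedPrefix R H E y j) j

/-- The gate kind is past-measurable. [folklore] -/
theorem isGate_eq_of_agree {y y' : Fin N → Bool} {j : ℕ} (h : ∀ i : Fin N, i.val < j → y i = y' i) :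
    isGate R H E y S j = isGate R H E y' S j := by
  unfold isGate isFair; rw [shedPrefix_eq_of_agree R H E h]

/-- Unfolding a gate. [folklore] -/
theorem isGate_iff (j : ℕ) : isGate R H E y S j = true ↔
    isFair R H E y j = true ∧ goodExitL R E S (shedPrefix R H E y j) j = true := by
  unfold isGate; rw [Bool.and_eq_true]

/-- **A gate is never a test**: at a gate the colour of `j` is the front's colour. [folklore] -/
theorem isTest_eq_false_of_isGate {j : ℕ} (hjN : j ≤ N) (hg : isGate R H E y S j = true) : isTest R H E y S j = false := by
  rw [isGate_iff, goodExitL_iff] at hg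
  obtain ⟨hfair, _, _, _, hcol⟩ := hg
  have h0 := hcol 0 (Nat.zero_le _)
  rw [freeIter_zero, add_zero] at h0
  have hne := ((isFair_iff R H E y j).1 hfair).2.2.1
  unfold isTest
  rw [hfair, Bool.true_and]
  have : posColour S j = posColour S (frontPos (shedPrefix R H E y j)) := by
    rw [h0, frontPos_eq_openTime R H E y hjN hne]
    exact pcolL_eq R H E y S hjN hne
  rw [this]; simp

/-! ### The kind and the designated value fed to the passage pricing -/

/-- The KIND of coin `j` of the bit string `v`: `1` (forced) at a test, `2` (soft) at a gate, `0` (free) otherwise. [folklore] -/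
def kind (j : ℕ) (v : Fin N → Bool) : ℕ :=
  if isTest R H E v S j = true then 1 else if isGate R H E v S j = true then 2 else 0

/-- The DESIGNATED VALUE of coin `j`: `U` (`true`) at a test, `D` (`false`) otherwise. [folklore] -/
def desig (j : ℕ) (v : Fin N → Bool) : Bool := isTest R H E v S j

/-- Kind and designated value are past-measurable. [folklore] -/
theorem kind_eq_of_agree (j : ℕ) (v w : Fin N → Bool) (h : ∀ i : Fin N, i.val < j → v i = w i) :
    kind R H E S j v = kind R H E S j w ∧ desig R H E S j v = desig R H E S j w := by
  unfold kind desig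
  rw [isTest_eq_of_agree R H E S h, isGate_eq_of_agree R H E S h]
  exact ⟨rfl, rfl⟩

/-- `kind = 1` iff test. [folklore] -/
theorem kind_eq_one_iff (j : ℕ) (v : Fin N → Bool) : kind R H E S j v = 1 ↔ isTest R H E v S j = true := by
  unfold kind
  by_cases h1 : isTest R H E v S j = true <;> by_cases h2 : isGate R H E v S j = true <;> simp [h1, h2]

/-- `kind = 2` iff gate and not test. [folklore] -/
theorem kind_eq_two_iff (j : ℕ) (v : Fin N → Bool) :
    kind R H E S j v = 2 ↔ isTest R H E v S j = false ∧ isGate R H E v S j = true := by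
  unfold kind
  by_cases h1 : isTest R H E v S j = true <;> by_cases h2 : isGate R H E v S j = true <;> simp_all

/-! ### The three-case lemma and the counting lemma -/

/-- **THREE-CASE LEMMA.**  Colours `σq b` of the non-defect positions `b = 0, 1, …` after a good-exit coin of a front of colour
`c` with look-ahead length `L` and look-ahead colour `cL ≠ c` (`σq L = cL`); if the front is still in place at position `a ≥ 1`
with no test in between (`σq b = c` for `b < a`) then position `a` is not a good exit (`σq a = c`, `σq (a + l) = c` for
`1 ≤ l < L` would contradict `σq L = cL` in each of the cases `a > L`, `a = L`, `a < L`). [folklore] -/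
theorem no_two_goodExits {σq : ℕ → Bool} {c cL : Bool} {L a : ℕ} (hcL : cL ≠ c) (ha : 1 ≤ a)
    (h0 : ∀ b, b < a → σq b = c) (h1L : σq L = cL) (h2 : σq a = c)
    (h2l : ∀ l, 1 ≤ l → l < L → σq (a + l) = c) : False := by
  rcases Nat.lt_trichotomy L a with h | h | h
  · exact hcL (h1L.symm.trans (h0 L h))
  · subst h; exact hcL (h1L.symm.trans h2)
  · have := h2l (L - a) (by omega) (by omega)
    rw [Nat.add_sub_cancel' h.le] at this
    exact hcL (h1L.symm.trans this)

/-- **Counting lemma**: if strictly between any two elements of `G` lies an element of `T`, then `#G ≤ #T + 1`. [folklore] -/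
theorem card_le_card_add_one_of_between (G T : Finset ℕ)
    (h : ∀ g ∈ G, ∀ g' ∈ G, g < g' → ∃ t ∈ T, g < t ∧ t < g') : G.card ≤ T.card + 1 := by
  -- the stronger statement `#s ≤ #{t ∈ T : t < max s} + 1` by induction on the maximum
  suffices hmain : ∀ s : Finset ℕ, s ⊆ G → s.card ≤ (T.filter fun t => ∃ x ∈ s, t < x).card + 1 by
    exact (hmain G Subset.rfl).trans (Nat.add_le_add_right (card_filter_le _ _) 1)
  intro s
  induction s using Finset.induction_on_max with
  | empty => intro; simp
  | insert a s hlt ih =>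
    intro hsub
    have hs : s ⊆ G := (subset_insert a s).trans hsub
    have ha : a ∈ G := hsub (mem_insert_self a s)
    have hnot : a ∉ s := fun h' => lt_irrefl a (hlt a h')
    rw [card_insert_of_notMem hnot]
    rcases s.eq_empty_or_nonempty with hse | hne
    · subst hse; simp
    · have ih := ih hs
      have hgs : s.max' hne ∈ s := max'_mem s hne
      obtain ⟨t₀, ht₀T, hgt₀, ht₀a⟩ := h (s.max' hne) (hs hgs) a ha (hlt _ hgs)
      -- the old filter misses `t₀`, the new one contains it and the old one
      have hsub' : (T.filter fun t => ∃ x ∈ s, t < x) ⊆ (T.filter fun t => ∃ x ∈ insert a s, t < x).erase t₀ := by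
        intro t ht
        rw [mem_filter] at ht
        obtain ⟨htT, x, hxs, htx⟩ := ht
        rw [mem_erase, mem_filter]
        refine ⟨?_, htT, x, mem_insert_of_mem hxs, htx⟩
        rintro rfl
        exact absurd (lt_of_lt_of_le htx (le_max' s x hxs)) (not_lt.2 hgt₀.le)
      have ht₀mem : t₀ ∈ (T.filter fun t => ∃ x ∈ insert a s, t < x) :=
        mem_filter.2 ⟨ht₀T, a, mem_insert_self a s, ht₀a⟩
      have hlt' := (card_le_card hsub').trans_lt (card_erase_lt_of_mem ht₀mem)
      omega

end Summit.ValiantsHypothesis.ValiantsHypothesis.Theorems.FifoMatching.NNLinearDegreeCofactorHard.ShedWord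

end
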